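import Summits.Ventures.DiscreteObjects.Hadamard.ConferenceGraph333OrderSummary
import Summits.Ventures.DiscreteObjects.Hadamard.ConferenceGraph333PGroupFixed

/-!
# Large primes in Aut(srg(333,166,82,83)): no element of order p·q for p ∈ {5,7,11}, q ∈ {37,41,83}, nor of order
# 37·41, 37·83, 41·83, 4·83, 8·37 (kernel)

Framing: lottery ticket; floor = certified bounds/negative ranges.  Cell pub-namedobj (venture DiscreteObjects),
target (H) = `H(668)`, hadamard gen 30.  Towards sharpening the element-order census (`ConferenceGraph333OrderSummaryG30`: `orderOf σ ∣ 2⁶·3³·5·7·11·37·41·83`)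
for the three large primes, the remaining products are excluded (imports kept to gen 29's `OrderSummary` + gen 30's `PGroupFixed`):
* `no_aut_order_205/287/451` (`5·41, 7·41, 11·41`), `no_aut_order_259/407` (`7·37, 11·37`), `no_aut_order_415/581/913`
  (`5·83, 7·83, 11·83`), `no_aut_order_1517/3071/3403` (`37·41, 37·83, 41·83`) — each from gen 29's
  `aut_two_primes_facts_odd` (fixed points of the two prime-order powers, windows, parities) by one `omega`;
* `no_aut_order_332` (`4·83`: census kit) — so `83 ∣ orderOf σ` leaves `83, 166`;
* `no_aut_order_296` (`8·37`): the power `σ⁸` of order `37` is fixed-point-free, so by the `37`-group congruence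
  (`pgroup_card_modEq_card_fixed`) the fixed sets of `σ³⁷, σ⁷⁴, σ¹⁴⁸` have size `≡ 0 (mod 37)`; with the `2`-power windows and the
  involution law they are all `37`, leaving `296` points in `37` cycles of length `8` of `σ³⁷` — an odd number, against cycle parity;
* `aut_orderOf_not_dvd_g30b` — the thirteen exclusions in `orderOf` form; the conclusions
  `37 ∣ orderOf σ ⇒ orderOf σ ∈ {37,74,148}`, `41 ⇒ {41,82}`, `83 ⇒ {83,166}` are drawn in `ConferenceGraph333LargePrimeOrders`.
WORDS: structure of a HYPOTHETICAL object; ours (PROVISIONAL).  No `sorry`, no new definitions.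
-/

namespace Summit.Ventures.DiscreteObjects.Hadamard

open Finset

section largeprimes
variable {V : Type*} [Fintype V] [DecidableEq V]

/-- **No automorphism of order `205 = 5·41`** (two-primes facts of gen 29 + omega). -/
theorem no_aut_order_205 (hV : Fintype.card V = 333) (A : Matrix V V ℤ)
    (h01 : ∀ x y, A x y = 0 ∨ A x y = 1) (hsymm : ∀ x y, A y x = A x y) (hdiag : ∀ x, A x x = 0)
    (hk : ∀ x, ∑ y, A x y = 166) (hsrg : ∀ x y, ∑ z, A x z * A z y = 83 * (1 + (if x = y then 1 else 0)) - A x y)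
    (τ : Equiv.Perm V) (hτ : τ ^ (5 * 41) = 1) (hτp : τ ^ 5 ≠ 1) (hτq : τ ^ 41 ≠ 1)
    (hA : ∀ x y, A (τ x) (τ y) = A x y) : False := by
  obtain ⟨a, b, c, mb, hab, hac, hdb, hdc, hun, ⟨hb1, hb2, hb3, hb4⟩, -, hC, ha2, hb2', hc2⟩ :=
    aut_two_primes_facts_odd hV A h01 hsymm hdiag hk hsrg (by norm_num) (by norm_num) (by norm_num) τ hτ hτp hτq hA
  obtain ⟨mc, hc1, hc2', hc3, hc4⟩ := hC (by norm_num)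
  obtain ⟨kb, hkb⟩ := hdb
  obtain ⟨kc, hkc⟩ := hdc
  have ha := ha2 (by norm_num)
  clear hb4
  clear hc4
  have hbo := hb2' (by norm_num)
  have hco := hc2 (by norm_num)
  omega

/-- **No automorphism of order `287 = 7·41`** (two-primes facts of gen 29 + omega). -/
theorem no_aut_order_287 (hV : Fintype.card V = 333) (A : Matrix V V ℤ)
    (h01 : ∀ x y, A x y = 0 ∨ A x y = 1) (hsymm : ∀ x y, A y x = A x y) (hdiag : ∀ x, A x x = 0)
    (hk : ∀ x, ∑ y, A x y = 166) (hsrg : ∀ x y, ∑ z, A x z * A z y = 83 * (1 + (if x = y then 1 else 0)) - A x y)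
    (τ : Equiv.Perm V) (hτ : τ ^ (7 * 41) = 1) (hτp : τ ^ 7 ≠ 1) (hτq : τ ^ 41 ≠ 1)
    (hA : ∀ x y, A (τ x) (τ y) = A x y) : False := by
  obtain ⟨a, b, c, mb, hab, hac, hdb, hdc, hun, ⟨hb1, hb2, hb3, hb4⟩, -, hC, ha2, hb2', hc2⟩ :=
    aut_two_primes_facts_odd hV A h01 hsymm hdiag hk hsrg (by norm_num) (by norm_num) (by norm_num) τ hτ hτp hτq hA
  obtain ⟨mc, hc1, hc2', hc3, hc4⟩ := hC (by norm_num)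
  obtain ⟨kb, hkb⟩ := hdb
  obtain ⟨kc, hkc⟩ := hdc
  have ha := ha2 (by norm_num)
  clear hb4
  obtain ⟨⟨jc, hjc⟩, hc5⟩ := hc4 (by norm_num)
  have hbo := hb2' (by norm_num)
  have hco := hc2 (by norm_num)
  omega

/-- **No automorphism of order `451 = 11·41`** (two-primes facts of gen 29 + omega). -/
theorem no_aut_order_451 (hV : Fintype.card V = 333) (A : Matrix V V ℤ)
    (h01 : ∀ x y, A x y = 0 ∨ A x y = 1) (hsymm : ∀ x y, A y x = A x y) (hdiag : ∀ x, A x x = 0)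
    (hk : ∀ x, ∑ y, A x y = 166) (hsrg : ∀ x y, ∑ z, A x z * A z y = 83 * (1 + (if x = y then 1 else 0)) - A x y)
    (τ : Equiv.Perm V) (hτ : τ ^ (11 * 41) = 1) (hτp : τ ^ 11 ≠ 1) (hτq : τ ^ 41 ≠ 1)
    (hA : ∀ x y, A (τ x) (τ y) = A x y) : False := by
  obtain ⟨a, b, c, mb, hab, hac, hdb, hdc, hun, ⟨hb1, hb2, hb3, hb4⟩, -, hC, ha2, hb2', hc2⟩ :=
    aut_two_primes_facts_odd hV A h01 hsymm hdiag hk hsrg (by norm_num) (by norm_num) (by norm_num) τ hτ hτp hτq hA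
  obtain ⟨mc, hc1, hc2', hc3, hc4⟩ := hC (by norm_num)
  obtain ⟨kb, hkb⟩ := hdb
  obtain ⟨kc, hkc⟩ := hdc
  have ha := ha2 (by norm_num)
  clear hb4
  obtain ⟨⟨jc, hjc⟩, hc5⟩ := hc4 (by norm_num)
  have hbo := hb2' (by norm_num)
  have hco := hc2 (by norm_num)
  omega

/-- **No automorphism of order `259 = 7·37`** (two-primes facts of gen 29 + omega). -/
theorem no_aut_order_259 (hV : Fintype.card V = 333) (A : Matrix V V ℤ)
    (h01 : ∀ x y, A x y = 0 ∨ A x y = 1) (hsymm : ∀ x y, A y x = A x y) (hdiag : ∀ x, A x x = 0)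
    (hk : ∀ x, ∑ y, A x y = 166) (hsrg : ∀ x y, ∑ z, A x z * A z y = 83 * (1 + (if x = y then 1 else 0)) - A x y)
    (τ : Equiv.Perm V) (hτ : τ ^ (7 * 37) = 1) (hτp : τ ^ 7 ≠ 1) (hτq : τ ^ 37 ≠ 1)
    (hA : ∀ x y, A (τ x) (τ y) = A x y) : False := by
  obtain ⟨a, b, c, mb, hab, hac, hdb, hdc, hun, ⟨hb1, hb2, hb3, hb4⟩, -, hC, ha2, hb2', hc2⟩ :=
    aut_two_primes_facts_odd hV A h01 hsymm hdiag hk hsrg (by norm_num) (by norm_num) (by norm_num) τ hτ hτp hτq hA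
  obtain ⟨mc, hc1, hc2', hc3, hc4⟩ := hC (by norm_num)
  obtain ⟨kb, hkb⟩ := hdb
  obtain ⟨kc, hkc⟩ := hdc
  clear ha2
  clear hb4
  obtain ⟨⟨jc, hjc⟩, hc5⟩ := hc4 (by norm_num)
  clear hb2'
  have hco := hc2 (by norm_num)
  omega

/-- **No automorphism of order `407 = 11·37`** (two-primes facts of gen 29 + omega). -/
theorem no_aut_order_407 (hV : Fintype.card V = 333) (A : Matrix V V ℤ)
    (h01 : ∀ x y, A x y = 0 ∨ A x y = 1) (hsymm : ∀ x y, A y x = A x y) (hdiag : ∀ x, A x x = 0)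
    (hk : ∀ x, ∑ y, A x y = 166) (hsrg : ∀ x y, ∑ z, A x z * A z y = 83 * (1 + (if x = y then 1 else 0)) - A x y)
    (τ : Equiv.Perm V) (hτ : τ ^ (11 * 37) = 1) (hτp : τ ^ 11 ≠ 1) (hτq : τ ^ 37 ≠ 1)
    (hA : ∀ x y, A (τ x) (τ y) = A x y) : False := by
  obtain ⟨a, b, c, mb, hab, hac, hdb, hdc, hun, ⟨hb1, hb2, hb3, hb4⟩, -, hC, ha2, hb2', hc2⟩ :=
    aut_two_primes_facts_odd hV A h01 hsymm hdiag hk hsrg (by norm_num) (by norm_num) (by norm_num) τ hτ hτp hτq hA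
  obtain ⟨mc, hc1, hc2', hc3, hc4⟩ := hC (by norm_num)
  obtain ⟨kb, hkb⟩ := hdb
  obtain ⟨kc, hkc⟩ := hdc
  clear ha2
  clear hb4
  obtain ⟨⟨jc, hjc⟩, hc5⟩ := hc4 (by norm_num)
  clear hb2'
  have hco := hc2 (by norm_num)
  omega

/-- **No automorphism of order `415 = 5·83`** (two-primes facts of gen 29 + omega). -/
theorem no_aut_order_415 (hV : Fintype.card V = 333) (A : Matrix V V ℤ)
    (h01 : ∀ x y, A x y = 0 ∨ A x y = 1) (hsymm : ∀ x y, A y x = A x y) (hdiag : ∀ x, A x x = 0)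
    (hk : ∀ x, ∑ y, A x y = 166) (hsrg : ∀ x y, ∑ z, A x z * A z y = 83 * (1 + (if x = y then 1 else 0)) - A x y)
    (τ : Equiv.Perm V) (hτ : τ ^ (5 * 83) = 1) (hτp : τ ^ 5 ≠ 1) (hτq : τ ^ 83 ≠ 1)
    (hA : ∀ x y, A (τ x) (τ y) = A x y) : False := by
  obtain ⟨a, b, c, mb, hab, hac, hdb, hdc, hun, ⟨hb1, hb2, hb3, hb4⟩, -, hC, ha2, hb2', hc2⟩ :=
    aut_two_primes_facts_odd hV A h01 hsymm hdiag hk hsrg (by norm_num) (by norm_num) (by norm_num) τ hτ hτp hτq hA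
  obtain ⟨mc, hc1, hc2', hc3, hc4⟩ := hC (by norm_num)
  obtain ⟨kb, hkb⟩ := hdb
  obtain ⟨kc, hkc⟩ := hdc
  have ha := ha2 (by norm_num)
  obtain ⟨⟨jb, hjb⟩, hb5⟩ := hb4 (by norm_num)
  clear hc4
  have hbo := hb2' (by norm_num)
  have hco := hc2 (by norm_num)
  omega

/-- **No automorphism of order `581 = 7·83`** (two-primes facts of gen 29 + omega). -/
theorem no_aut_order_581 (hV : Fintype.card V = 333) (A : Matrix V V ℤ)
    (h01 : ∀ x y, A x y = 0 ∨ A x y = 1) (hsymm : ∀ x y, A y x = A x y) (hdiag : ∀ x, A x x = 0)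
    (hk : ∀ x, ∑ y, A x y = 166) (hsrg : ∀ x y, ∑ z, A x z * A z y = 83 * (1 + (if x = y then 1 else 0)) - A x y)
    (τ : Equiv.Perm V) (hτ : τ ^ (7 * 83) = 1) (hτp : τ ^ 7 ≠ 1) (hτq : τ ^ 83 ≠ 1)
    (hA : ∀ x y, A (τ x) (τ y) = A x y) : False := by
  obtain ⟨a, b, c, mb, hab, hac, hdb, hdc, hun, ⟨hb1, hb2, hb3, hb4⟩, -, hC, ha2, hb2', hc2⟩ :=
    aut_two_primes_facts_odd hV A h01 hsymm hdiag hk hsrg (by norm_num) (by norm_num) (by norm_num) τ hτ hτp hτq hA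
  obtain ⟨mc, hc1, hc2', hc3, hc4⟩ := hC (by norm_num)
  obtain ⟨kb, hkb⟩ := hdb
  obtain ⟨kc, hkc⟩ := hdc
  have ha := ha2 (by norm_num)
  obtain ⟨⟨jb, hjb⟩, hb5⟩ := hb4 (by norm_num)
  obtain ⟨⟨jc, hjc⟩, hc5⟩ := hc4 (by norm_num)
  have hbo := hb2' (by norm_num)
  have hco := hc2 (by norm_num)
  omega

/-- **No automorphism of order `913 = 11·83`** (two-primes facts of gen 29 + omega). -/
theorem no_aut_order_913 (hV : Fintype.card V = 333) (A : Matrix V V ℤ)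
    (h01 : ∀ x y, A x y = 0 ∨ A x y = 1) (hsymm : ∀ x y, A y x = A x y) (hdiag : ∀ x, A x x = 0)
    (hk : ∀ x, ∑ y, A x y = 166) (hsrg : ∀ x y, ∑ z, A x z * A z y = 83 * (1 + (if x = y then 1 else 0)) - A x y)
    (τ : Equiv.Perm V) (hτ : τ ^ (11 * 83) = 1) (hτp : τ ^ 11 ≠ 1) (hτq : τ ^ 83 ≠ 1)
    (hA : ∀ x y, A (τ x) (τ y) = A x y) : False := by
  obtain ⟨a, b, c, mb, hab, hac, hdb, hdc, hun, ⟨hb1, hb2, hb3, hb4⟩, -, hC, ha2, hb2', hc2⟩ :=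
    aut_two_primes_facts_odd hV A h01 hsymm hdiag hk hsrg (by norm_num) (by norm_num) (by norm_num) τ hτ hτp hτq hA
  obtain ⟨mc, hc1, hc2', hc3, hc4⟩ := hC (by norm_num)
  obtain ⟨kb, hkb⟩ := hdb
  obtain ⟨kc, hkc⟩ := hdc
  have ha := ha2 (by norm_num)
  obtain ⟨⟨jb, hjb⟩, hb5⟩ := hb4 (by norm_num)
  obtain ⟨⟨jc, hjc⟩, hc5⟩ := hc4 (by norm_num)
  have hbo := hb2' (by norm_num)
  have hco := hc2 (by norm_num)
  omega

/-- **No automorphism of order `1517 = 37·41`** (two-primes facts of gen 29 + omega). -/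
theorem no_aut_order_1517 (hV : Fintype.card V = 333) (A : Matrix V V ℤ)
    (h01 : ∀ x y, A x y = 0 ∨ A x y = 1) (hsymm : ∀ x y, A y x = A x y) (hdiag : ∀ x, A x x = 0)
    (hk : ∀ x, ∑ y, A x y = 166) (hsrg : ∀ x y, ∑ z, A x z * A z y = 83 * (1 + (if x = y then 1 else 0)) - A x y)
    (τ : Equiv.Perm V) (hτ : τ ^ (37 * 41) = 1) (hτp : τ ^ 37 ≠ 1) (hτq : τ ^ 41 ≠ 1)
    (hA : ∀ x y, A (τ x) (τ y) = A x y) : False := by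
  obtain ⟨a, b, c, mb, hab, hac, hdb, hdc, hun, ⟨hb1, hb2, hb3, hb4⟩, -, hC, ha2, hb2', hc2⟩ :=
    aut_two_primes_facts_odd hV A h01 hsymm hdiag hk hsrg (by norm_num) (by norm_num) (by norm_num) τ hτ hτp hτq hA
  obtain ⟨mc, hc1, hc2', hc3, hc4⟩ := hC (by norm_num)
  obtain ⟨kb, hkb⟩ := hdb
  obtain ⟨kc, hkc⟩ := hdc
  clear ha2
  clear hb4
  clear hc4
  have hbo := hb2' (by norm_num)
  clear hc2
  omega

/-- **No automorphism of order `3071 = 37·83`** (two-primes facts of gen 29 + omega). -/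
theorem no_aut_order_3071 (hV : Fintype.card V = 333) (A : Matrix V V ℤ)
    (h01 : ∀ x y, A x y = 0 ∨ A x y = 1) (hsymm : ∀ x y, A y x = A x y) (hdiag : ∀ x, A x x = 0)
    (hk : ∀ x, ∑ y, A x y = 166) (hsrg : ∀ x y, ∑ z, A x z * A z y = 83 * (1 + (if x = y then 1 else 0)) - A x y)
    (τ : Equiv.Perm V) (hτ : τ ^ (37 * 83) = 1) (hτp : τ ^ 37 ≠ 1) (hτq : τ ^ 83 ≠ 1)
    (hA : ∀ x y, A (τ x) (τ y) = A x y) : False := by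
  obtain ⟨a, b, c, mb, hab, hac, hdb, hdc, hun, ⟨hb1, hb2, hb3, hb4⟩, -, hC, ha2, hb2', hc2⟩ :=
    aut_two_primes_facts_odd hV A h01 hsymm hdiag hk hsrg (by norm_num) (by norm_num) (by norm_num) τ hτ hτp hτq hA
  obtain ⟨mc, hc1, hc2', hc3, hc4⟩ := hC (by norm_num)
  obtain ⟨kb, hkb⟩ := hdb
  obtain ⟨kc, hkc⟩ := hdc
  clear ha2
  obtain ⟨⟨jb, hjb⟩, hb5⟩ := hb4 (by norm_num)
  clear hc4
  have hbo := hb2' (by norm_num)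
  clear hc2
  omega

/-- **No automorphism of order `3403 = 41·83`** (two-primes facts of gen 29 + omega). -/
theorem no_aut_order_3403 (hV : Fintype.card V = 333) (A : Matrix V V ℤ)
    (h01 : ∀ x y, A x y = 0 ∨ A x y = 1) (hsymm : ∀ x y, A y x = A x y) (hdiag : ∀ x, A x x = 0)
    (hk : ∀ x, ∑ y, A x y = 166) (hsrg : ∀ x y, ∑ z, A x z * A z y = 83 * (1 + (if x = y then 1 else 0)) - A x y)
    (τ : Equiv.Perm V) (hτ : τ ^ (41 * 83) = 1) (hτp : τ ^ 41 ≠ 1) (hτq : τ ^ 83 ≠ 1)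
    (hA : ∀ x y, A (τ x) (τ y) = A x y) : False := by
  obtain ⟨a, b, c, mb, hab, hac, hdb, hdc, hun, ⟨hb1, hb2, hb3, hb4⟩, -, hC, ha2, hb2', hc2⟩ :=
    aut_two_primes_facts_odd hV A h01 hsymm hdiag hk hsrg (by norm_num) (by norm_num) (by norm_num) τ hτ hτp hτq hA
  obtain ⟨mc, hc1, hc2', hc3, hc4⟩ := hC (by norm_num)
  obtain ⟨kb, hkb⟩ := hdb
  obtain ⟨kc, hkc⟩ := hdc
  have ha := ha2 (by norm_num)
  obtain ⟨⟨jb, hjb⟩, hb5⟩ := hb4 (by norm_num)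
  clear hc4
  have hbo := hb2' (by norm_num)
  have hco := hc2 (by norm_num)
  omega

/-- **No automorphism of order `332 = 4·83`** (census kit: `Fix σ⁴ = 1` forces one fixed point and a `332`-cycle, against the
orbit bound). -/
theorem no_aut_order_332 (hV : Fintype.card V = 333) (A : Matrix V V ℤ)
    (h01 : ∀ x y, A x y = 0 ∨ A x y = 1) (hsymm : ∀ x y, A y x = A x y) (hdiag : ∀ x, A x x = 0)
    (hk : ∀ x, ∑ y, A x y = 166) (hsrg : ∀ x y, ∑ z, A x z * A z y = 83 * (1 + (if x = y then 1 else 0)) - A x y)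
    (σ : Equiv.Perm V) (hσ : σ ^ 332 = 1) (hσ166 : σ ^ 166 ≠ 1) (hσ4 : σ ^ 4 ≠ 1) (hA : ∀ x y, A (σ x) (σ y) = A x y) :
    False := by
  have hAk := adj_pow_invariant A σ hA
  obtain ⟨c, h1, h2, -, h4, h6⟩ := aut_cycle_length_census hV A h01 hsymm hdiag hk hsrg σ hσ (by norm_num) hA
  have hD : Nat.divisors 332 = {1, 2, 4, 83, 166, 332} := by decide
  have f1 := h2 1
  have f4 := h2 4
  have f166 := h2 166
  have e2 := h6 2 (by norm_num)
  have e4 := h6 4 (by norm_num)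
  have e83 := h6 83 (by norm_num)
  have e166 := h6 166 (by norm_num)
  have e332 := h6 332 (by norm_num)
  have o332 := h4 332 (by norm_num)
  rw [pow_one] at f1
  simp only [hD, Finset.sum_filter] at h1 f1 f4 f166
  norm_num at h1 f1 f4 f166
  rw [f1] at o332
  have hp166 : (σ ^ 166) ^ 2 = 1 := by rw [← pow_mul]; exact hσ
  have hinv166 : ∀ x, (σ ^ 166) ((σ ^ 166) x) = x := fun x => by
    have := congrArg (fun g : Equiv.Perm V => g x) hp166
    simpa [pow_two] using this
  obtain ⟨-, wl166⟩ := involution_window hV A h01 hsymm hdiag hk hsrg (σ ^ 166) hinv166 hσ166 (hAk 166)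
  rw [f166] at wl166
  have hp4 : (σ ^ 4) ^ 83 = 1 := by rw [← pow_mul]; exact hσ
  obtain ⟨-, -, -, -, -, -, -, -, -, w4⟩ :=
    aut_prime_windows_fs hV A h01 hsymm hdiag hk hsrg (by norm_num : Nat.Prime 83) (by norm_num) (σ ^ 4) hp4 hσ4 (hAk 4)
  have hw4 := w4 rfl
  rw [f4] at hw4
  clear hAk h2 h4 h6 hD hA hsrg hk hdiag hsymm h01 hσ hp166 hp4
  rcases o332 with o332a | o332b <;> omega

/-- **No automorphism of order `296 = 8·37`.**  With `τ = σ³⁷` (order `8`) and `ρ = σ⁸` (order `37`, fixed-point-free): the fixed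
sets of `τ, τ², τ⁴` are `ρ`-invariant, hence of size `≡ 0 (mod 37)`; with `#Fix τ ≤ 40` odd, `#Fix τ² ≤ 82`, `#Fix τ⁴ ≤ 165`,
`≡ 1 (mod 4)` and the cycle parities of `τ` they are all `37`, leaving `296` points in `8`-cycles of `τ` — but `16 ∣ c₈`. -/
theorem no_aut_order_296 (hV : Fintype.card V = 333) (A : Matrix V V ℤ)
    (h01 : ∀ x y, A x y = 0 ∨ A x y = 1) (hsymm : ∀ x y, A y x = A x y) (hdiag : ∀ x, A x x = 0)
    (hk : ∀ x, ∑ y, A x y = 166) (hsrg : ∀ x y, ∑ z, A x z * A z y = 83 * (1 + (if x = y then 1 else 0)) - A x y)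
    (σ : Equiv.Perm V) (hσ : σ ^ 296 = 1) (hσ148 : σ ^ 148 ≠ 1) (hσ8 : σ ^ 8 ≠ 1) (hA : ∀ x y, A (σ x) (σ y) = A x y) :
    False := by
  have hAk := adj_pow_invariant A σ hA
  set τ := σ ^ 37 with hτ_def
  set ρ := σ ^ 8 with hρ_def
  have hτ8 : τ ^ 8 = 1 := by rw [hτ_def, ← pow_mul]; exact hσ
  have hτ4 : τ ^ 4 ≠ 1 := by rw [hτ_def, ← pow_mul]; exact hσ148
  have hρ37 : ρ ^ 37 = 1 := by rw [hρ_def, ← pow_mul]; exact hσ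
  have hρ1 : ρ ≠ 1 := hσ8
  have hAτ : ∀ x y, A (τ x) (τ y) = A x y := hAk 37
  have hAρ : ∀ x y, A (ρ x) (ρ y) = A x y := hAk 8
  -- census kit for τ (order 8)
  obtain ⟨c, h1, h2, -, -, h6⟩ := aut_cycle_length_census hV A h01 hsymm hdiag hk hsrg τ hτ8 (by norm_num) hAτ
  have hD : Nat.divisors 8 = {1, 2, 4, 8} := by decide
  have f1 := h2 1
  have f2 := h2 2
  have f4 := h2 4
  have e2 := h6 2 (by norm_num)
  have e4 := h6 4 (by norm_num)
  have e8 := h6 8 (by norm_num)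
  rw [pow_one] at f1
  simp only [hD, Finset.sum_filter] at h1 f1 f2 f4
  norm_num at h1 f1 f2 f4
  -- ρ is fixed-point free (order 37)
  obtain ⟨-, -, -, -, -, -, -, w37, -, -⟩ :=
    aut_prime_windows_fs hV A h01 hsymm hdiag hk hsrg (by norm_num : Nat.Prime 37) (by norm_num) ρ hρ37 hρ1 hAρ
  have hF0 : (univ.filter fun y => ρ y = y).card = 0 := w37 rfl
  -- the 37-congruences: Fix(τ^i) is ρ-invariant
  haveI : Fact (Nat.Prime 37) := ⟨by norm_num⟩
  have hPG := isPGroup_zpowers_of_pow_eq_one ρ (p := 37) (e := 1) (by simpa using hρ37)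
  have hcomm : ∀ i : ℕ, ∀ y, ρ ((τ ^ i) y) = (τ ^ i) (ρ y) := by
    intro i y
    have : ρ * τ ^ i = τ ^ i * ρ := by rw [hρ_def, hτ_def, ← pow_mul, ← pow_add, ← pow_add, add_comm]
    exact congrArg (fun g : Equiv.Perm V => g y) this
  have hmod : ∀ i : ℕ, 37 ∣ (univ.filter fun y => (τ ^ i) y = y).card := by
    intro i
    have hS : ∀ g ∈ Subgroup.zpowers ρ, ∀ y ∈ (univ.filter fun y => (τ ^ i) y = y), g y ∈ (univ.filter fun y => (τ ^ i) y = y) := by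
      intro g hg y hy
      obtain ⟨k, rfl⟩ := Subgroup.mem_zpowers_iff.mp hg
      rw [Finset.mem_filter] at hy ⊢
      refine ⟨Finset.mem_univ _, ?_⟩
      -- (τ^i) ((ρ^k) y) = (ρ^k) ((τ^i) y) = (ρ^k) y
      have hc : Commute (ρ ^ k) (τ ^ i) := by
        have h0 : Commute ρ (τ ^ i) := Equiv.ext fun y => hcomm i y
        exact h0.zpow_left k
      have := congrArg (fun g : Equiv.Perm V => g y) hc.eq
      simp only [Equiv.Perm.coe_mul, Function.comp_apply] at this
      rw [← this, hy.2]
    have h := pgroup_card_modEq_card_fixed (Subgroup.zpowers ρ) hPG _ (mem_filter_fixed_iff_zpowers ρ) _ hS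
    have hle : ((univ.filter fun y => (τ ^ i) y = y) ∩ (univ.filter fun y => ρ y = y)).card = 0 := by
      apply Nat.eq_zero_of_le_zero
      rw [← hF0]
      exact Finset.card_le_card Finset.inter_subset_right
    rw [hle] at h
    exact Nat.dvd_of_mod_eq_zero h
  have m1 := hmod 1
  have m2 := hmod 2
  have m4 := hmod 4
  rw [pow_one, f1] at m1
  rw [f2] at m2
  rw [f4] at m4
  -- windows for τ, τ², τ⁴
  obtain ⟨-, hodd⟩ := aut_card_fixed_odd hV A h01 hsymm hdiag hk hsrg τ hτ8 (by norm_num) hAτ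
  rw [f1] at hodd
  have hb1 := aut_prime_pow_order_bound hV A h01 hsymm hdiag hk hsrg τ hAτ (by norm_num : Nat.Prime 2) 2
    (by simpa using hτ8) (by simpa using hτ4)
  norm_num at hb1
  rw [f1] at hb1
  have hτ2ne : τ ^ 2 ≠ 1 := fun h => hτ4 (by rw [show (4:ℕ) = 2 * 2 by norm_num, pow_mul, h, one_pow])
  have hb2 := aut_prime_pow_order_bound hV A h01 hsymm hdiag hk hsrg (τ ^ 2) (adj_pow_invariant A τ hAτ 2)
    (by norm_num : Nat.Prime 2) 1 (by rw [← pow_mul]; simpa using hτ8) (by rw [← pow_mul]; simpa using hτ4)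
  norm_num at hb2
  rw [f2] at hb2
  have hp4 : (τ ^ 4) ^ 2 = 1 := by rw [← pow_mul]; exact hτ8
  have hinv4 : ∀ x, (τ ^ 4) ((τ ^ 4) x) = x := fun x => by
    have := congrArg (fun g : Equiv.Perm V => g x) hp4
    simpa [pow_two] using this
  obtain ⟨wl4a, wl4b⟩ := involution_window hV A h01 hsymm hdiag hk hsrg (τ ^ 4) hinv4 hτ4 (adj_pow_invariant A τ hAτ 4)
  rw [f4] at wl4a wl4b
  clear hAk h2 h6 hD hA hsrg hk hdiag hsymm h01 hσ hmod hcomm hPG hp4 hinv4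
  omega

/-- **Excluded divisors of `orderOf σ` (gen 30, part b).** -/
theorem aut_orderOf_not_dvd_g30b (hV : Fintype.card V = 333) (A : Matrix V V ℤ)
    (h01 : ∀ x y, A x y = 0 ∨ A x y = 1) (hsymm : ∀ x y, A y x = A x y) (hdiag : ∀ x, A x x = 0)
    (hk : ∀ x, ∑ y, A x y = 166) (hsrg : ∀ x y, ∑ z, A x z * A z y = 83 * (1 + (if x = y then 1 else 0)) - A x y)
    (σ : Equiv.Perm V) (hA : ∀ x y, A (σ x) (σ y) = A x y) {m : ℕ}
    (hm : m ∈ ({205, 259, 287, 296, 332, 407, 415, 451, 581, 913, 1517, 3071, 3403} : Finset ℕ)) : ¬ m ∣ orderOf σ := by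
  intro hdvd
  have hAk := adj_pow_invariant A σ hA
  obtain ⟨h1, hne⟩ := pow_orderOf_div_facts σ hdvd
  simp only [Finset.mem_insert, Finset.mem_singleton] at hm
  rcases hm with rfl | rfl | rfl | rfl | rfl | rfl | rfl | rfl | rfl | rfl | rfl | rfl | rfl
  · exact no_aut_order_205 hV A h01 hsymm hdiag hk hsrg (σ ^ (orderOf σ / 205)) (by norm_num [h1] : (σ ^ (orderOf σ / 205)) ^ (5 * 41) = 1)
      (hne 5 (by norm_num) (by norm_num)) (hne 41 (by norm_num) (by norm_num)) (hAk _)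
  · exact no_aut_order_259 hV A h01 hsymm hdiag hk hsrg (σ ^ (orderOf σ / 259)) (by norm_num [h1] : (σ ^ (orderOf σ / 259)) ^ (7 * 37) = 1)
      (hne 7 (by norm_num) (by norm_num)) (hne 37 (by norm_num) (by norm_num)) (hAk _)
  · exact no_aut_order_287 hV A h01 hsymm hdiag hk hsrg (σ ^ (orderOf σ / 287)) (by norm_num [h1] : (σ ^ (orderOf σ / 287)) ^ (7 * 41) = 1)
      (hne 7 (by norm_num) (by norm_num)) (hne 41 (by norm_num) (by norm_num)) (hAk _)
  · exact no_aut_order_296 hV A h01 hsymm hdiag hk hsrg (σ ^ (orderOf σ / 296)) h1 (hne 148 (by norm_num) (by norm_num))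
      (hne 8 (by norm_num) (by norm_num)) (hAk _)
  · exact no_aut_order_332 hV A h01 hsymm hdiag hk hsrg (σ ^ (orderOf σ / 332)) h1 (hne 166 (by norm_num) (by norm_num))
      (hne 4 (by norm_num) (by norm_num)) (hAk _)
  · exact no_aut_order_407 hV A h01 hsymm hdiag hk hsrg (σ ^ (orderOf σ / 407)) (by norm_num [h1] : (σ ^ (orderOf σ / 407)) ^ (11 * 37) = 1)
      (hne 11 (by norm_num) (by norm_num)) (hne 37 (by norm_num) (by norm_num)) (hAk _)
  · exact no_aut_order_415 hV A h01 hsymm hdiag hk hsrg (σ ^ (orderOf σ / 415)) (by norm_num [h1] : (σ ^ (orderOf σ / 415)) ^ (5 * 83) = 1)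
      (hne 5 (by norm_num) (by norm_num)) (hne 83 (by norm_num) (by norm_num)) (hAk _)
  · exact no_aut_order_451 hV A h01 hsymm hdiag hk hsrg (σ ^ (orderOf σ / 451)) (by norm_num [h1] : (σ ^ (orderOf σ / 451)) ^ (11 * 41) = 1)
      (hne 11 (by norm_num) (by norm_num)) (hne 41 (by norm_num) (by norm_num)) (hAk _)
  · exact no_aut_order_581 hV A h01 hsymm hdiag hk hsrg (σ ^ (orderOf σ / 581)) (by norm_num [h1] : (σ ^ (orderOf σ / 581)) ^ (7 * 83) = 1)
      (hne 7 (by norm_num) (by norm_num)) (hne 83 (by norm_num) (by norm_num)) (hAk _)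
  · exact no_aut_order_913 hV A h01 hsymm hdiag hk hsrg (σ ^ (orderOf σ / 913)) (by norm_num [h1] : (σ ^ (orderOf σ / 913)) ^ (11 * 83) = 1)
      (hne 11 (by norm_num) (by norm_num)) (hne 83 (by norm_num) (by norm_num)) (hAk _)
  · exact no_aut_order_1517 hV A h01 hsymm hdiag hk hsrg (σ ^ (orderOf σ / 1517)) (by norm_num [h1] : (σ ^ (orderOf σ / 1517)) ^ (37 * 41) = 1)
      (hne 37 (by norm_num) (by norm_num)) (hne 41 (by norm_num) (by norm_num)) (hAk _)
  · exact no_aut_order_3071 hV A h01 hsymm hdiag hk hsrg (σ ^ (orderOf σ / 3071)) (by norm_num [h1] : (σ ^ (orderOf σ / 3071)) ^ (37 * 83) = 1)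
      (hne 37 (by norm_num) (by norm_num)) (hne 83 (by norm_num) (by norm_num)) (hAk _)
  · exact no_aut_order_3403 hV A h01 hsymm hdiag hk hsrg (σ ^ (orderOf σ / 3403)) (by norm_num [h1] : (σ ^ (orderOf σ / 3403)) ^ (41 * 83) = 1)
      (hne 41 (by norm_num) (by norm_num)) (hne 83 (by norm_num) (by norm_num)) (hAk _)

end largeprimes

end Summit.Ventures.DiscreteObjects.Hadamard
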